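import Summits.QuantumFields.YangMills.Theorems.UnitScaleTiltProp8ChartDoubleBarStar
import Summits.QuantumFields.YangMills.Theorems.UnitScaleTiltProp8FlatPlaqDeriv
import HarnessLib

/-!
# Route `UnitScaleTilt`, crux K1 «MinimiserStabilityRegPr» (stmt-QuantumFields-19200), stub V2′ `stub_halvingStep` — pillar P3, the double-bar chart of record:
# **THE DETERMINANT THROUGH THE DOUBLE-BAR TOWER**: `det U̿^{(j)}(U) = U̿^{(j)}_ℂ(det∘U)` — the determinant of the double-bar average of an `M₂(ℂ)ˣ`-field is the (abelian)
# double-bar average, on the SAME lattice with `𝔸 = ℂ`, of its determinant field; hence `tr Q♭(A)(j,c) = Q♭_ℂ(tr∘A)(j,c)` (★★OWNER ACK 34 (3): route (ab), file 1 of 2)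

Cell `ym3-torus` (HUMAN RULING D-0037: YM₃ on the torus is ladder rung R3, not the Clay problem), width seat `ym-ust-19200-w8` g0∕s2.
`--supports stmt-QuantumFields-19200 --as helper`; definition-free, 0 sorry.

WHY.  Census row S11 `hU` (LOCATED ✗): the dressed competitor must be TRACELESS.  Route (ab): `tr C♭(Z) = 0` for EVERY `Z` in the ball, because (this file) the trace of the ♭ chart is the ♭
chart of the trace field at `𝔸 = ℂ`, and (file 2, `…ChartDoubleBarAbelian`) at `𝔸 = ℂ` the ♭ chart IS its linearisation.  [Balaban1985Variational] (47): `D` is 𝔤-valued since the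
`U(1)` part of the average is exactly linear.

WHAT THIS FILE PROVES (no definition, no sorry; `M₂(ℂ)`, L²-operator norm):
* §1 the branch letter **`trace_mlog_eq_mlog_det`** — `tr (log W) = log (det W)` (series logarithms) on the EXPLICIT ball `‖W − 1‖ ≤ 1∕16` (both are logarithms of `det W`; `|tr log W| ≤ ¼`,
  `|log det W| ≤ 1`, closer than `2π`).
* §2 the relation `det ↑u = ↑z` between an `M₂(ℂ)ˣ`-field and a `ℂˣ`-field through the tower: `detRel_one∕_mul∕_inv`, `det_emlUnit` (`det (eml W) = eml (det∘W)` on `1∕16`-small tuples),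
  **`det_dbarAvgU`** (two-block near-flatness `64ℓs ≤ 1`), **`det_dbarIterU_of_reads`** (budget `30400·ℓ²·Lⁱ·s₀ ≤ 1`), base `det_coe_expCfg` (`det e^{iηA(b)} = e^{iη tr A(b)}`).
* §3 ★★ **`trace_chartLogFlat_eq_of_reads`** ∕ ★★ **`trace_chartLogFlat_eq_weightedBall₀`**: `tr (chartLogFlat η D A (j,c)) = chartLogFlat η D (tr∘A) (j,c)` (right side at `𝔸 = ℂ`).
HONEST SCOPE.  Bookkeeping over landed letters (template ✓`holT_rel_of_walk`).  NOT a claim about the stub, the crux, the rung or the mass gap.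

References: T. Bałaban, CMP **102** (1985) [Balaban1985Variational] (20) p.281, (47) p.285, p.307; CMP **109** (1987) [Balaban1987RG1] (0.4)–(0.9) p.253; CMP **98** (1985)
[Balaban1985Averaging] (21)–(26) pp.21–22, (89) p.31.
-/

set_option autoImplicit false

noncomputable section

open scoped BigOperators
open NormedSpace

namespace Summit.QuantumFields.YangMills.Theorems.Prop8ChartDoubleBar

open Literature.MathematicalPhysics.QuantumFieldTheory.Balaban1983to89
open T4Continuum BlockAveraging AveragingRT ExpMeanLog MatrixLog
open B10Eq27TorusAxialLog (holT)
open B5Eq118OneStroke (iterBlockOf iterBlockOf_succ iterBlockOf_zero)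
open B6SectADomainsV1 (Domains)
open B6SectAOperatorsV1 (BondIdx)
open T3ContinuumYM3Torus (T3Family)
open Summit.QuantumFields.YangMills.Theorems.FlatCubeOpsText (IsLevWeight)
open Summit.QuantumFields.YangMills.Theorems.Prop8Chart
open Literature.Analysis.Matrix (det_exp_eq_exp_trace)
open FlatPlaqDeriv (norm_trace_le_two_mul)

variable {P : Params}

section Det

open scoped Matrix.Norms.L2Operator

/-! ## §1 The branch letter `tr log = log det` near `1` -/

/-- **`tr (log W) = log (det W)`** on `‖W − 1‖ ≤ 1∕16`, with `log` the series logarithm on `M₂(ℂ)` resp. `ℂ`: both are logarithms of `det W` (`det e^{G} = e^{tr G}`, `e^{log z} = z`),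
`|tr log W| ≤ 4‖W − 1‖ ≤ ¼`, `|det W − 1| ≤ ½`, `|log det W| ≤ 1`, and two logarithms of one number closer than `2π` agree. [cite: Balaban1985Averaging, (21)-(26) pp.21-22] -/
theorem trace_mlog_eq_mlog_det {W : Matrix (Fin 2) (Fin 2) ℂ} (hW : ‖W - 1‖ ≤ 1 / 16) : Matrix.trace (mlog W) = mlog W.det := by
  letI : NormedAlgebra ℚ (Matrix (Fin 2) (Fin 2) ℂ) := NormedAlgebra.restrictScalars ℚ ℂ _
  set a : ℂ := Matrix.trace (mlog W) with ha
  have hW1 : ‖W - 1‖ < 1 := lt_of_le_of_lt hW (by norm_num)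
  have hG : ‖mlog W‖ ≤ 2 * ‖W - 1‖ := norm_mlog_le_two_mul (hW.trans (by norm_num))
  have han : ‖a‖ ≤ 1 / 4 := by
    have := norm_trace_le_two_mul (mlog W)
    rw [ha]; linarith
  have hdet : W.det = Complex.exp a := by
    rw [ha, ← exp_mlog hW1, det_exp_eq_exp_trace, Complex.exp_eq_exp_ℂ, exp_mlog hW1]
  have hd1 : ‖W.det - 1‖ ≤ 1 / 2 := by
    rw [hdet]
    have := Complex.norm_exp_sub_one_le (x := a) (by linarith)
    linarith
  set b : ℂ := mlog W.det with hb
  have hbn : ‖b‖ ≤ 1 := by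
    have := norm_mlog_le_two_mul hd1
    rw [hb]; linarith
  have hexpb : Complex.exp b = W.det := by
    rw [Complex.exp_eq_exp_ℂ, hb]
    exact exp_mlog (lt_of_le_of_lt hd1 (by norm_num))
  -- two logarithms of `det W`
  obtain ⟨k, hk⟩ := Complex.exp_eq_exp_iff_exists_int.1 (hdet.symm.trans hexpb.symm)
  have hk0 : (k : ℂ) * (2 * Real.pi * Complex.I) = a - b := by rw [hk]; ring
  have hnorm : ‖(k : ℂ) * (2 * Real.pi * Complex.I)‖ = |(k : ℝ)| * (2 * Real.pi) := by
    rw [norm_mul, norm_mul, norm_mul, Complex.norm_I, mul_one, Complex.norm_intCast, Complex.norm_real, Complex.norm_ofNat,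
      Real.norm_of_nonneg Real.pi_pos.le]
  have hsmall : |(k : ℝ)| * (2 * Real.pi) < 1 * (2 * Real.pi) := by
    rw [← hnorm, hk0, one_mul]
    have := Real.pi_gt_three
    linarith [norm_sub_le a b]
  have hk1 : |(k : ℝ)| < 1 := lt_of_mul_lt_mul_right hsmall (by positivity)
  have hkz : k = 0 := by
    have : |k| < 1 := by exact_mod_cast hk1
    exact Int.abs_lt_one_iff.1 this
  rw [hkz] at hk
  simpa using hk

/-! ## §2 The determinant through the tower: `M₂(ℂ)ˣ`-fields and their `ℂˣ` determinant fields -/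

/-- `det 1 = 1`. [folklore] -/
theorem detRel_one : (((1 : (Matrix (Fin 2) (Fin 2) ℂ)ˣ)) : Matrix (Fin 2) (Fin 2) ℂ).det = (((1 : ℂˣ)) : ℂ) := by
  rw [Units.val_one, Matrix.det_one, Units.val_one]

/-- `det (ab) = det a · det b`. [folklore] -/
theorem detRel_mul {a b : (Matrix (Fin 2) (Fin 2) ℂ)ˣ} {z v : ℂˣ} (ha : (a : Matrix (Fin 2) (Fin 2) ℂ).det = (z : ℂ)) (hb : (b : Matrix (Fin 2) (Fin 2) ℂ).det = (v : ℂ)) :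
    ((a * b : (Matrix (Fin 2) (Fin 2) ℂ)ˣ) : Matrix (Fin 2) (Fin 2) ℂ).det = ((z * v : ℂˣ) : ℂ) := by
  rw [Units.val_mul, Matrix.det_mul, ha, hb, Units.val_mul]

/-- `det (a⁻¹) = (det a)⁻¹`. [folklore] -/
theorem detRel_inv {a : (Matrix (Fin 2) (Fin 2) ℂ)ˣ} {z : ℂˣ} (ha : (a : Matrix (Fin 2) (Fin 2) ℂ).det = (z : ℂ)) :
    ((a⁻¹ : (Matrix (Fin 2) (Fin 2) ℂ)ˣ) : Matrix (Fin 2) (Fin 2) ℂ).det = ((z⁻¹ : ℂˣ) : ℂ) := by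
  have h := congrArg Matrix.det a.mul_inv
  rw [Matrix.det_mul, Matrix.det_one, ha] at h
  rw [Units.val_inv_eq_inv_val, eq_inv_of_mul_eq_one_right h]

/-- **`det (eml W) = eml (det ∘ W)`** on a `1∕16`-small tuple, at the level of the units `(isUnit_eml ·).unit` (`det e^{c·Σ log Wᵢ} = e^{c·Σ tr log Wᵢ} = e^{c·Σ log det Wᵢ}`).
[cite: Balaban1987RG1, (0.4)-(0.9) p.253] -/
theorem det_emlUnit {W : Idx P → Matrix (Fin 2) (Fin 2) ℂ} {d : Idx P → ℂ} (hW : ∀ i, ‖W i - 1‖ ≤ 1 / 16) (hd : ∀ i, (W i).det = d i) :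
    (((isUnit_eml W).unit : (Matrix (Fin 2) (Fin 2) ℂ)ˣ) : Matrix (Fin 2) (Fin 2) ℂ).det = (((isUnit_eml d).unit : ℂˣ) : ℂ) := by
  letI : NormedAlgebra ℚ (Matrix (Fin 2) (Fin 2) ℂ) := NormedAlgebra.restrictScalars ℚ ℂ _
  rw [IsUnit.unit_spec, IsUnit.unit_spec, eml_eq_exp, eml_eq_exp, det_exp_eq_exp_trace, Matrix.trace_smul, Matrix.trace_sum]
  congr 1
  rw [smul_eq_mul, smul_eq_mul]
  congr 1
  exact Finset.sum_congr rfl fun i _ => by rw [trace_mlog_eq_mlog_det (hW i), hd i]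

/-- **ONE DOUBLE-BAR STEP COMMUTES WITH THE DETERMINANT** on the two blocks of `c`: if `det ↑(S b) = ↑(Sd b)` on the two-block bonds, which are within `s` of `1`, `64ℓs ≤ 1`, then
`det U̿(c) = U̿_ℂ(c)` for the scalar field `Sd`. [cite: Balaban1985Averaging, (89) p.31, (110) p.34; Balaban1987RG1, (0.4)-(0.9) p.253] -/
theorem det_dbarAvgU {j : ℕ} (hj : j + 1 ≤ P.m + P.K) {S : GaugeField P j (Matrix (Fin 2) (Fin 2) ℂ)ˣ} {Sd : GaugeField P j ℂˣ} (c : PBond P (j + 1)) {s : ℝ} (hs0 : 0 ≤ s)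
    (hℓs : 64 * (((P.d + 2) * P.L : ℕ) : ℝ) * s ≤ 1)
    (hS : ∀ b : PBond P j, (blockOf b.src = c.src ∨ blockOf b.src = c.tgt) → (blockOf b.tgt = c.src ∨ blockOf b.tgt = c.tgt) →
      ‖((S b : (Matrix (Fin 2) (Fin 2) ℂ)ˣ) : Matrix (Fin 2) (Fin 2) ℂ) - 1‖ ≤ s)
    (hdet : ∀ b : PBond P j, (blockOf b.src = c.src ∨ blockOf b.src = c.tgt) → (blockOf b.tgt = c.src ∨ blockOf b.tgt = c.tgt) →
      ((S b : (Matrix (Fin 2) (Fin 2) ℂ)ˣ) : Matrix (Fin 2) (Fin 2) ℂ).det = ((Sd b : ℂˣ) : ℂ)) :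
    ((dbarAvgU S c : (Matrix (Fin 2) (Fin 2) ℂ)ˣ) : Matrix (Fin 2) (Fin 2) ℂ).det = ((dbarAvgU Sd c : ℂˣ) : ℂ) := by
  have hℓ0 : 0 ≤ (((P.d + 2) * P.L : ℕ) : ℝ) * s := by positivity
  have hℓs4 : 4 * (((P.d + 2) * P.L : ℕ) : ℝ) * s ≤ 1 := by linarith
  have hsx : 4 * (((P.d + 2) * P.L : ℕ) : ℝ) * s ≤ 1 / 16 := by linarith
  -- the relation along walks that read related bonds
  have hwalk : ∀ (x : Site P j) (w : List (Letter P.d)),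
      (∀ st ∈ walk x w, ((S st.bond : (Matrix (Fin 2) (Fin 2) ℂ)ˣ) : Matrix (Fin 2) (Fin 2) ℂ).det = ((Sd st.bond : ℂˣ) : ℂ)) →
      ((holT S x w : (Matrix (Fin 2) (Fin 2) ℂ)ˣ) : Matrix (Fin 2) (Fin 2) ℂ).det = ((holT Sd x w : ℂˣ) : ℂ) :=
    fun x w hw => holT_rel_of_walk (fun (a : (Matrix (Fin 2) (Fin 2) ℂ)ˣ) (z : ℂˣ) => (a : Matrix (Fin 2) (Fin 2) ℂ).det = (z : ℂ))
      detRel_one (fun _ _ _ _ ha hb => detRel_mul ha hb) (fun _ _ ha => detRel_inv ha) S Sd x w hw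
  -- the frames
  have hframe : ∀ y : Site P (j + 1), (y = c.src ∨ y = c.tgt) →
      ((vframeU S y : (Matrix (Fin 2) (Fin 2) ℂ)ˣ) : Matrix (Fin 2) (Fin 2) ℂ).det = ((vframeU Sd y : ℂˣ) : ℂ) := by
    intro y hy
    have hSy : ∀ b : PBond P j, blockOf b.src = y → blockOf b.tgt = y → ‖((S b : (Matrix (Fin 2) (Fin 2) ℂ)ˣ) : Matrix (Fin 2) (Fin 2) ℂ) - 1‖ ≤ s := by
      intro b hb1 hb2
      exact hS b (by rw [hb1]; exact hy) (by rw [hb2]; exact hy)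
    refine det_emlUnit (fun i => ((norm_holT_stair_sub_one_le hj y hs0 hℓs4 hSy i).1).trans hsx) fun i => ?_
    refine hwalk _ _ fun st hst => hdet st.bond ?_ ?_
    · rw [(blockOf_ends_of_mem_stairWalk hj y i.1 i.2.1 st hst).1]; exact hy
    · rw [(blockOf_ends_of_mem_stairWalk hj y i.1 i.2.1 st hst).2]; exact hy
  -- the single-bar average
  have havg : ((emlAvgU S c : (Matrix (Fin 2) (Fin 2) ℂ)ˣ) : Matrix (Fin 2) (Fin 2) ℂ).det = ((emlAvgU Sd c : ℂˣ) : ℂ) := by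
    unfold emlAvgU
    refine detRel_mul (det_emlUnit (fun i => ((norm_loopHolU_sub_one_le hj c hs0 hℓs4 hS i).1).trans hsx) fun i => ?_) ?_
    · exact hwalk _ _ fun st hst => hdet st.bond (two_block_of_mem_loopWalk hj c i hst).1 (two_block_of_mem_loopWalk hj c i hst).2
    · exact hwalk _ _ fun st hst => hdet st.bond (two_block_of_mem_lineWalk hj c hst).1 (two_block_of_mem_lineWalk hj c hst).2
  rw [dbarAvgU_apply, dbarAvgU_apply]
  exact detRel_mul (detRel_mul (detRel_inv (hframe c.src (Or.inl rfl))) havg) (hframe c.tgt (Or.inr rfl))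

/-- **THE DOUBLE-BAR TOWER COMMUTES WITH THE DETERMINANT ON THE READ TERRITORY** (budget `30400·ℓ²·Lⁱ·s₀ ≤ 1`, `U` within `s₀` of `1` on the reads, `det ↑(U b) = ↑(Ud b)` there).
[cite: Balaban1985Averaging, Prop. 4 (134)-(135) p.38; Balaban1987RG1, (0.9) p.253] -/
theorem det_dbarIterU_of_reads :
    ∀ (i : ℕ), i ≤ P.m + P.K → ∀ (S : Set (Site P i)) (U : GaugeField P 0 (Matrix (Fin 2) (Fin 2) ℂ)ˣ) (Ud : GaugeField P 0 ℂˣ) (s₀ : ℝ), 0 ≤ s₀ →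
      8 * 3800 * (((P.d + 2) * P.L : ℕ) : ℝ) ^ 2 * (P.L : ℝ) ^ i * s₀ ≤ 1 →
      (∀ b : PBond P 0, iterBlockOf i b.src ∈ S → iterBlockOf i b.tgt ∈ S → ‖((U b : (Matrix (Fin 2) (Fin 2) ℂ)ˣ) : Matrix (Fin 2) (Fin 2) ℂ) - 1‖ ≤ s₀) →
      (∀ b : PBond P 0, iterBlockOf i b.src ∈ S → iterBlockOf i b.tgt ∈ S → ((U b : (Matrix (Fin 2) (Fin 2) ℂ)ˣ) : Matrix (Fin 2) (Fin 2) ℂ).det = ((Ud b : ℂˣ) : ℂ)) →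
      ∀ e : PBond P i, e.src ∈ S → e.tgt ∈ S →
        ((dbarIterU i U e : (Matrix (Fin 2) (Fin 2) ℂ)ˣ) : Matrix (Fin 2) (Fin 2) ℂ).det = ((dbarIterU i Ud e : ℂˣ) : ℂ) := by
  set ℓ : ℝ := (((P.d + 2) * P.L : ℕ) : ℝ) with hℓ
  have hℓ1 : (1 : ℝ) ≤ ℓ := by
    rw [hℓ]; exact_mod_cast Nat.one_le_iff_ne_zero.mpr (Nat.mul_ne_zero (by omega) (by have := P.hL.2; omega))
  have hL1 : (1 : ℝ) ≤ P.L := by exact_mod_cast P.L_pos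
  intro i
  induction i with
  | zero =>
    intro _ S U Ud s₀ _ _ _ hdet e hs ht
    rw [dbarIterU_zero, dbarIterU_zero]
    exact hdet e (by simpa only [iterBlockOf_zero] using hs) (by simpa only [iterBlockOf_zero] using ht)
  | succ i ih =>
    intro hi S U Ud s₀ hs₀ hbudget hU hdet c hcs hct
    have hbudget_i : 8 * 3800 * ℓ ^ 2 * (P.L : ℝ) ^ i * s₀ ≤ 1 := by
      refine le_trans ?_ hbudget
      have : (P.L : ℝ) ^ i ≤ (P.L : ℝ) ^ (i + 1) := pow_le_pow_right₀ hL1 (Nat.le_succ i)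
      have h0 : 0 ≤ 8 * 3800 * ℓ ^ 2 * s₀ := by positivity
      nlinarith
    set S' : Set (Site P i) := {y | blockOf y ∈ S} with hS'
    have hU' : ∀ b : PBond P 0, iterBlockOf i b.src ∈ S' → iterBlockOf i b.tgt ∈ S' →
        ‖((U b : (Matrix (Fin 2) (Fin 2) ℂ)ˣ) : Matrix (Fin 2) (Fin 2) ℂ) - 1‖ ≤ s₀ :=
      fun b hs ht => hU b (by rw [iterBlockOf_succ]; exact hs) (by rw [iterBlockOf_succ]; exact ht)
    have hdet' : ∀ b : PBond P 0, iterBlockOf i b.src ∈ S' → iterBlockOf i b.tgt ∈ S' →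
        ((U b : (Matrix (Fin 2) (Fin 2) ℂ)ˣ) : Matrix (Fin 2) (Fin 2) ℂ).det = ((Ud b : ℂˣ) : ℂ) :=
      fun b hs ht => hdet b (by rw [iterBlockOf_succ]; exact hs) (by rw [iterBlockOf_succ]; exact ht)
    have hF := ih (Nat.le_of_succ_le hi) S' U Ud s₀ hs₀ hbudget_i hU' hdet'
    have hnear : ∀ e : PBond P i, e.src ∈ S' → e.tgt ∈ S' →
        ‖((dbarIterU i U e : (Matrix (Fin 2) (Fin 2) ℂ)ˣ) : Matrix (Fin 2) (Fin 2) ℂ) - 1‖ ≤ 2 * ((P.L : ℝ) ^ i * s₀) :=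
      fun e hs ht => norm_dbarIterU_sub_one_le_two_mul₀ (Nat.le_of_succ_le hi) S' U hs₀ hbudget_i hU' e hs ht
    rw [dbarIterU_succ, dbarIterU_succ]
    have hmem : ∀ b : PBond P i, (blockOf b.src = c.src ∨ blockOf b.src = c.tgt) → (blockOf b.tgt = c.src ∨ blockOf b.tgt = c.tgt) →
        b.src ∈ S' ∧ b.tgt ∈ S' := by
      intro b hbs hbt
      refine ⟨show blockOf b.src ∈ S from ?_, show blockOf b.tgt ∈ S from ?_⟩
      · rcases hbs with h | h <;> rw [h]; exacts [hcs, hct]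
      · rcases hbt with h | h <;> rw [h]; exacts [hcs, hct]
    have h2x : 0 ≤ 2 * ((P.L : ℝ) ^ i * s₀) := by positivity
    have h64 : 64 * (((P.d + 2) * P.L : ℕ) : ℝ) * (2 * ((P.L : ℝ) ^ i * s₀)) ≤ 1 := by
      rw [← hℓ]
      have hx0 : 0 ≤ (P.L : ℝ) ^ i * s₀ := by positivity
      have hb' : 8 * 3800 * ℓ ^ 2 * ((P.L : ℝ) ^ i * s₀) ≤ 1 := by
        have : 8 * 3800 * ℓ ^ 2 * ((P.L : ℝ) ^ i * s₀) = 8 * 3800 * ℓ ^ 2 * (P.L : ℝ) ^ i * s₀ := by ring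
        rw [this]; exact hbudget_i
      nlinarith [mul_le_mul_of_nonneg_right hℓ1 (by positivity : (0 : ℝ) ≤ ℓ * ((P.L : ℝ) ^ i * s₀))]
    exact det_dbarAvgU hi c h2x h64 (fun b hbs hbt => hnear b (hmem b hbs hbt).1 (hmem b hbs hbt).2)
      fun b hbs hbt => hF b (hmem b hbs hbt).1 (hmem b hbs hbt).2

/-- **`det e^{iηA(b)} = e^{iη·tr A(b)}`**: the determinant field of the charted configuration is the charted configuration of the trace field (Liouville).
[cite: Balaban1985Variational, (152) p.301] -/
theorem det_coe_expCfg (η : ℝ) (A : PBond P 0 → Matrix (Fin 2) (Fin 2) ℂ) (b : PBond P 0) :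
    (((expCfg η A b : (Matrix (Fin 2) (Fin 2) ℂ)ˣ)) : Matrix (Fin 2) (Fin 2) ℂ).det = ((expCfg η (fun b => Matrix.trace (A b)) b : ℂˣ) : ℂ) := by
  letI : NormedAlgebra ℚ (Matrix (Fin 2) (Fin 2) ℂ) := NormedAlgebra.restrictScalars ℚ ℂ _
  rw [coe_expCfg, coe_expCfg, det_exp_eq_exp_trace, Matrix.trace_smul]

/-! ## §3 The trace of the double-bar chart is the double-bar chart of the trace -/

/-- ★★ **`tr Q♭(A)(j,c) = Q♭_ℂ(tr∘A)(j,c)` (index form, guarded)** under the read budget of ✓`norm_chartLogFlat_apply_le_of_reads` with B1 plugged: the determinant of `U̿^{(j)}(e^{iηA})(c)` is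
the scalar double-bar average of `e^{iη tr A}`, and `tr log = log det` on `‖· − 1‖ ≤ 1∕16`. [cite: Balaban1985Variational, (20) p.281, (47) p.285, p.307] -/
theorem trace_chartLogFlat_eq_of_reads (η : ℝ) (D : Domains P) (idx : BondIdx D) (A₀ : PBond P 0 → Matrix (Fin 2) (Fin 2) ℂ) {s₀ : ℝ} (hs₀ : 0 ≤ s₀)
    (hbudget : 8 * 3800 * (((P.d + 2) * P.L : ℕ) : ℝ) ^ 2 * (P.L : ℝ) ^ (idx.1.1 : ℕ) * s₀ ≤ 1)
    (hA : ∀ b : PBond P 0, (iterBlockOf (idx.1.1 : ℕ) b.src = idx.1.2.src ∨ iterBlockOf (idx.1.1 : ℕ) b.src = idx.1.2.tgt) →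
      (iterBlockOf (idx.1.1 : ℕ) b.tgt = idx.1.2.src ∨ iterBlockOf (idx.1.1 : ℕ) b.tgt = idx.1.2.tgt) →
      ‖((expCfg η A₀ b : (Matrix (Fin 2) (Fin 2) ℂ)ˣ) : Matrix (Fin 2) (Fin 2) ℂ) - 1‖ ≤ s₀) :
    Matrix.trace (chartLogFlat η D A₀ idx) = chartLogFlat η D (fun b => Matrix.trace (A₀ b)) idx := by
  have hj : (idx.1.1 : ℕ) ≤ P.m + P.K := (Nat.lt_succ_iff.mp idx.1.1.isLt).trans D.hk
  set S : Set (Site P (idx.1.1 : ℕ)) := {y | y = idx.1.2.src ∨ y = idx.1.2.tgt} with hS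
  have hA' : ∀ b : PBond P 0, iterBlockOf (idx.1.1 : ℕ) b.src ∈ S → iterBlockOf (idx.1.1 : ℕ) b.tgt ∈ S →
      ‖((expCfg η A₀ b : (Matrix (Fin 2) (Fin 2) ℂ)ˣ) : Matrix (Fin 2) (Fin 2) ℂ) - 1‖ ≤ s₀ := fun b hs ht => hA b hs ht
  have hdet := det_dbarIterU_of_reads (idx.1.1 : ℕ) hj S (expCfg η A₀) (expCfg η fun b => Matrix.trace (A₀ b)) s₀ hs₀ hbudget hA'
    (fun b _ _ => det_coe_expCfg η A₀ b) idx.1.2 (Or.inl rfl) (Or.inr rfl)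
  have hnear := norm_dbarIterU_sub_one_le_two_mul₀ hj S (expCfg η A₀) hs₀ hbudget hA' idx.1.2 (Or.inl rfl) (Or.inr rfl)
  have hℓ1 : (1 : ℝ) ≤ (((P.d + 2) * P.L : ℕ) : ℝ) := by
    exact_mod_cast Nat.one_le_iff_ne_zero.mpr (Nat.mul_ne_zero (by omega) (by have := P.hL.2; omega))
  have hsx : ‖((dbarIterU (idx.1.1 : ℕ) (expCfg η A₀) idx.1.2 : (Matrix (Fin 2) (Fin 2) ℂ)ˣ) : Matrix (Fin 2) (Fin 2) ℂ) - 1‖ ≤ 1 / 16 := by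
    refine hnear.trans ?_
    have h0 : 0 ≤ (P.L : ℝ) ^ (idx.1.1 : ℕ) * s₀ := by positivity
    have h1 : 8 * 3800 * (((P.d + 2) * P.L : ℕ) : ℝ) ^ 2 * ((P.L : ℝ) ^ (idx.1.1 : ℕ) * s₀) ≤ 1 := by
      have : 8 * 3800 * (((P.d + 2) * P.L : ℕ) : ℝ) ^ 2 * ((P.L : ℝ) ^ (idx.1.1 : ℕ) * s₀) =
          8 * 3800 * (((P.d + 2) * P.L : ℕ) : ℝ) ^ 2 * (P.L : ℝ) ^ (idx.1.1 : ℕ) * s₀ := by ring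
      rw [this]; exact hbudget
    nlinarith [(one_le_pow₀ (M₀ := ℝ) hℓ1 : (1:ℝ) ≤ _ ^ 2)]
  rw [chartLogFlat_apply, chartLogFlat_apply, Matrix.trace_smul, trace_mlog_eq_mlog_det hsx, hdet, smul_eq_mul]

/-- ★★ **`tr Q♭(A) = Q♭_ℂ(tr∘A)` ON THE WEIGHTED BALL OF RECORD** (letters of ✓`norm_chartLogFlat_le_weightedBall₀`), at every index. [cite: Balaban1985Variational, (20) p.281, (47) p.285] -/
theorem trace_chartLogFlat_eq_weightedBall₀ (F : T3Family) (n K : ℕ) (D : Domains (F.P K)) (hDk : D.k = K - n)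
    (hcollar : ∀ (i : ℕ) (e : PBond (F.P K) (i + 1)), D.LamBond (i + 1) e → ∀ z : Site (F.P K) i, (blockOf z = e.src ∨ blockOf z = e.tgt) → z ∈ D.Om i)
    {w : ℕ → PBond (F.P K) 0 → ℝ} (hw : IsLevWeight F n K D w)
    {R : ℝ} (hR : 16 * 3800 * ((((F.P K).d + 2) * (F.P K).L : ℕ) : ℝ) ^ 2 * (F.L : ℝ) * R ≤ 1)
    {A : PBond (F.P K) 0 → Matrix (Fin 2) (Fin 2) ℂ} (hA : ∀ b, w 1 b * ‖A b‖ < R) (idx : BondIdx D) :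
    Matrix.trace (chartLogFlat (((F.L : ℝ)⁻¹) ^ (K - n)) D A idx) = chartLogFlat (((F.L : ℝ)⁻¹) ^ (K - n)) D (fun b => Matrix.trace (A b)) idx := by
  have hL1 : (1 : ℝ) ≤ F.L := by exact_mod_cast (F.P K).L_pos
  have hL0 : (0 : ℝ) < F.L := by linarith
  have hℓ1 : (1 : ℝ) ≤ ((((F.P K).d + 2) * (F.P K).L : ℕ) : ℝ) := by
    exact_mod_cast Nat.one_le_iff_ne_zero.mpr (Nat.mul_ne_zero (by omega) (by have := (F.P K).hL.2; omega))
  have hLj : 0 < (F.L : ℝ) ^ (idx.1.1 : ℕ) := by positivity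
  have hR0 : 0 ≤ R := by
    have := hA (⟨fun _ => 0, idx.1.2.dir⟩ : PBond (F.P K) 0)
    have hw0 : 0 ≤ w 1 ⟨fun _ => 0, idx.1.2.dir⟩ * ‖A ⟨fun _ => 0, idx.1.2.dir⟩‖ := by
      rw [hw 1, pow_one]; exact mul_nonneg (by positivity) (norm_nonneg _)
    linarith
  have hLR : (F.L : ℝ) * R ≤ 1 := by
    have h16 : (1 : ℝ) ≤ 16 * 3800 * ((((F.P K).d + 2) * (F.P K).L : ℕ) : ℝ) ^ 2 := by
      nlinarith [(one_le_pow₀ (M₀ := ℝ) hℓ1 : (1:ℝ) ≤ _ ^ 2)]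
    nlinarith [mul_nonneg hL0.le hR0]
  set s₀ : ℝ := 2 * (F.L : ℝ) * R * ((F.L : ℝ) ^ (idx.1.1 : ℕ))⁻¹ with hs₀
  have hs₀0 : 0 ≤ s₀ := by positivity
  have hbudget : 8 * 3800 * ((((F.P K).d + 2) * (F.P K).L : ℕ) : ℝ) ^ 2 * (F.L : ℝ) ^ (idx.1.1 : ℕ) * s₀ ≤ 1 := by
    have : 8 * 3800 * ((((F.P K).d + 2) * (F.P K).L : ℕ) : ℝ) ^ 2 * (F.L : ℝ) ^ (idx.1.1 : ℕ) * s₀ =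
        16 * 3800 * ((((F.P K).d + 2) * (F.P K).L : ℕ) : ℝ) ^ 2 * (F.L : ℝ) * R := by
      rw [hs₀]; field_simp; ring
    rw [this]; exact hR
  have hA' : ∀ b : PBond (F.P K) 0, (iterBlockOf (idx.1.1 : ℕ) b.src = idx.1.2.src ∨ iterBlockOf (idx.1.1 : ℕ) b.src = idx.1.2.tgt) →
      (iterBlockOf (idx.1.1 : ℕ) b.tgt = idx.1.2.src ∨ iterBlockOf (idx.1.1 : ℕ) b.tgt = idx.1.2.tgt) →
      ‖((expCfg (((F.L : ℝ)⁻¹) ^ (K - n)) A b : (Matrix (Fin 2) (Fin 2) ℂ)ˣ) : Matrix (Fin 2) (Fin 2) ℂ) - 1‖ ≤ s₀ :=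
    fun b hb _ => norm_expCfg_sub_one_le_of_weightedBall_flat F n K D hDk hcollar hw hLR hA idx b hb
  have hLF : ((F.P K).L : ℝ) = F.L := by norm_cast
  exact trace_chartLogFlat_eq_of_reads (((F.L : ℝ)⁻¹) ^ (K - n)) D idx A hs₀0 (by rw [hLF]; exact hbudget) hA'

end Det

end Summit.QuantumFields.YangMills.Theorems.Prop8ChartDoubleBar

end
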